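import Mathlib
import Literature.Computability.Complexity.CliqueTestGraphs
import Summits.PneNP.PneNP.Theorems.ConvexRankGatesConvexGateBlindSharpJunta
import Summits.PneNP.PneNP.Theorems.ConvexRankGatesConvexGateBlindRainbowLevelExact

/-!
# PneNP / ConvexRankGates — `ConvexGateBlind`: junta certificates are blind as soon as the classes have size `t + 2`

Helpers (`--supports stmt-PneNP-10680`), concluding `…RainbowLevelSums.lean` / `…RainbowLevel.lean` / `…RainbowLevelExact.lean`.
THEOREM (`cdist_colorVec_not_juntaRep_small`, registered stub `junta_blind_small`): for a balanced colouring `h : Fin m → Fin K`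
with classes of common size `n`, a locality `w` with `2 ≤ w`, `w + 1 ≤ K`, `w + 1 ≤ n`, and EVERY `ε > 0`, there is NO identity

  `cdist Q (colorVec h) - ε = ∑_l F_l (Q ∩ S_l)`   on the `(K+1)`-sets `Q`,   `F_l ≥ 0`, `#S_l ≤ w`,

whatever the number of terms. Compared with `junta_blind` / `junta_blind_sharp` (`…JuntaBlind.lean`, `…SharpJunta.lean`),
which need classes of size `n ≥ K + 1 = k`, the class size only has to EXCEED THE LOCALITY, and this is exact: with
`#S_l = n` the class windows `g(|Q ∩ V_i|)`, `g(q) = (q-1)(q-2ε)/2`, represent the column (`…ClassWindow.lean`) — the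
locality threshold of a colouring column is EXACTLY ITS CLASS SIZE (for `n ≤ K`; for `n ≥ K + 1` it is `k`, `…SharpJunta.lean`).
Proof: integrate against the level-`t` functional `rbLt`, `t = w - 1`; its inclusion numbers up to level `t + 1 = w` are those
of the rainbow pseudo-distribution (`rbLt_indicator_succ`), so `L_t(1) = K n^K/(K+1) > 0`, `L_t(mono_h) = 0`, and the local
laws `μ_S(P) = L_t(𝟙[· ∩ S = P]) = [P rainbow] K n^{K-#P} R_A(K+1-#P)` (`rbLt_localLaw`, inclusion–exclusion) are `≥ 0` for
`#S ≤ w` by the sharp rainbow-sum bound `R_A(N) ≥ 1/N - #A/(n(N-1))` of `…SharpJunta.lean` (`#A + #P ≤ w`,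
`N = K + 1 - #P ≥ #A + 2`, `n ≥ #A + 1`). Consequence (`…SmallSymmetric.lean`): symmetric LP row objects must break the
symmetry of vertex blocks of size `O(⌈m^δ⌉)`. [new]
-/

namespace Summit.PneNP.PneNP.Theorems

open Finset Literature.Computability.Complexity
open Summit.PneNP.PneNP.Cruxes.ConvexGateBlind.StrictRankConicCover (Edge cdist monoPairs mem_monoPairs
  two_mul_cdist_colorVec)

set_option linter.dupNamespace false

noncomputable section

variable {m K : ℕ}

/-! ## Local laws of the level-`t` functional -/

/-- **Local law of the level-`t` functional.** For `P ⊆ S`, `#S ≤ t + 1` (`t + 2 ≤ K`, classes of size `n ≥ t + 2`):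
`L_t(𝟙[· ∩ S = P]) = [P rainbow] · K · n^{K - #P} · R_A(K + 1 - #P)` with `A` the vertices of `S ∖ P` whose colour is not
used by `P` — literally the local law of the rainbow pseudo-distribution (`rbL_localLaw`). -/
theorem rbLt_localLaw (h : Fin m → Fin K) {n t : ℕ} (hn : ∀ c, (cls h c).card = n) (htn : t + 2 ≤ n)
    (htK : t + 2 ≤ K) {S P : Finset (Fin m)} (hPS : P ⊆ S) (hS : S.card ≤ t + 1) :
    rbLt h n t (fun Q => if Q ∩ S = P then 1 else 0) =
      if Set.InjOn h ↑P then
        (K : ℝ) * (n : ℝ) ^ (K - P.card) *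
          rbSum h (n : ℝ) ((S \ P).filter fun v => h v ∉ P.image h) ((K : ℝ) + 1 - P.card)
      else 0 := by
  classical
  set A := (S \ P).filter fun v => h v ∉ P.image h with hA
  have hn0 : (n : ℝ) ≠ 0 := by
    have : 0 < n := by omega
    positivity
  -- inclusion–exclusion and the inclusion numbers
  rw [rbLt_congr_fun h n t (fun Q => indicator_inter_eq S P Q hPS), rbLt_sum]
  have hterm : ∀ T ∈ (S \ P).powerset, rbLt h n t (fun Q => (-1 : ℝ) ^ T.card * (if P ∪ T ⊆ Q then (1 : ℝ) else 0)) =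
      (-1 : ℝ) ^ T.card *
        (if Set.InjOn h ↑(P ∪ T) then (K : ℝ) * (n : ℝ) ^ (K - (P ∪ T).card) / ((K : ℝ) + 1 - (P ∪ T).card)
          else 0) := by
    intro T hT
    rw [mem_powerset] at hT
    rw [rbLt_smul, rbLt_indicator_succ h hn htn htK]
    exact (card_le_card (union_subset hPS (hT.trans sdiff_subset))).trans hS
  rw [Finset.sum_congr rfl hterm]
  split_ifs with hP
  · -- reduce to the rainbow alternating sum over `A`
    rw [rbSum, Finset.mul_sum]
    have hsplit : ∀ T ∈ (S \ P).powerset,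
        (-1 : ℝ) ^ T.card *
          (if Set.InjOn h ↑(P ∪ T) then (K : ℝ) * (n : ℝ) ^ (K - (P ∪ T).card) / ((K : ℝ) + 1 - (P ∪ T).card)
            else 0) =
        if T ⊆ A then (K : ℝ) * (n : ℝ) ^ (K - P.card) *
          (if Set.InjOn h ↑T then (-1 : ℝ) ^ T.card * ((n : ℝ)⁻¹) ^ T.card / ((K : ℝ) + 1 - P.card - T.card)
            else 0) else 0 := by
      intro T hT
      rw [mem_powerset] at hT
      have hdisj : Disjoint P T := by
        rw [Finset.disjoint_left]
        intro v hvP hvT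
        exact (mem_sdiff.1 (hT hvT)).2 hvP
      have hcardPT : (P ∪ T).card = P.card + T.card := card_union_of_disjoint hdisj
      have hTcard : P.card + T.card ≤ K := by
        rw [← hcardPT]
        exact ((card_le_card (union_subset hPS (hT.trans sdiff_subset))).trans hS).trans (by omega)
      by_cases hTA : T ⊆ A
      · rw [if_pos hTA]
        by_cases hTinj : Set.InjOn h ↑T
        · have hcol : ∀ v ∈ T, h v ∉ P.image h := fun v hv => (mem_filter.1 (hTA hv)).2
          rw [if_pos ((injOn_union_iff h hdisj).2 ⟨hP, hTinj, hcol⟩), if_pos hTinj, hcardPT]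
          have hpow : (n : ℝ) ^ (K - (P.card + T.card)) * (n : ℝ) ^ T.card = (n : ℝ) ^ (K - P.card) := by
            rw [← pow_add]; congr 1; omega
          have hden : (K : ℝ) + 1 - ((P.card + T.card : ℕ) : ℝ) = (K : ℝ) + 1 - P.card - T.card := by
            push_cast; ring
          rw [hden, inv_pow]
          have hnT : (n : ℝ) ^ T.card ≠ 0 := pow_ne_zero _ hn0
          field_simp
          rw [← hpow]
          ring
        · rw [if_neg (fun hu => hTinj ((injOn_union_iff h hdisj).1 hu).2.1), if_neg hTinj]
          simp
      · rw [if_neg hTA, if_neg]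
        · simp
        · intro hu
          apply hTA
          intro v hv
          exact mem_filter.2 ⟨hT hv, ((injOn_union_iff h hdisj).1 hu).2.2 v hv⟩
    rw [Finset.sum_congr rfl hsplit, ← Finset.sum_filter]
    have hAset : ((S \ P).powerset.filter fun T => T ⊆ A) = A.powerset := by
      ext T
      simp only [mem_filter, mem_powerset]
      constructor
      · exact fun hh => hh.2
      · exact fun hh => ⟨hh.trans (filter_subset _ _), hh⟩
    rw [hAset]
  · refine Finset.sum_eq_zero fun T hT => ?_
    rw [if_neg, mul_zero]
    intro hu
    exact hP (hu.mono (by rw [coe_union]; exact Set.subset_union_left))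

/-- **The local laws of the level-`t` functional are non-negative** for `#S ≤ t + 1`, `t + 2 ≤ K`, classes of size
`n ≥ t + 2`: by the sharp rainbow-sum bound `R_A(N) ≥ 1/N - #A/(n(N-1))` with `#A + #P ≤ t + 1`, `N = K + 1 - #P ≥ #A + 2`,
`n ≥ #A + 1`. -/
theorem rbLt_localLaw_nonneg (h : Fin m → Fin K) {n t : ℕ} (hn : ∀ c, (cls h c).card = n) (htn : t + 2 ≤ n)
    (htK : t + 2 ≤ K) {S P : Finset (Fin m)} (hPS : P ⊆ S) (hS : S.card ≤ t + 1) :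
    0 ≤ rbLt h n t (fun Q => if Q ∩ S = P then 1 else 0) := by
  classical
  rw [rbLt_localLaw h hn htn htK hPS hS]
  split_ifs with hP
  · refine mul_nonneg (by positivity) ?_
    set A := (S \ P).filter fun v => h v ∉ P.image h with hA
    have hAcard : A.card + P.card ≤ t + 1 := by
      have h1 : A.card ≤ (S \ P).card := card_filter_le _ _
      rw [card_sdiff_of_subset hPS] at h1
      have h2 := card_le_card hPS
      omega
    have hnpos : (0 : ℝ) < n := by
      have : 0 < n := by omega
      positivity
    have hcast : (K : ℝ) + 1 - P.card = ((K + 1 - P.card : ℕ) : ℝ) := by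
      rw [Nat.cast_sub (by omega)]; push_cast; ring
    rw [hcast]
    have hAn : (A.card : ℝ) ≤ n := by exact_mod_cast (show A.card ≤ n by omega)
    refine le_trans ?_ (rbSum_sharp_lower h hnpos A (K + 1 - P.card) (by omega) hAn)
    -- `1/N - a/(n(N-1)) ≥ 0` from `a + 2 ≤ N`, `a + 1 ≤ n`
    have hN2 : (A.card : ℝ) + 2 ≤ ((K + 1 - P.card : ℕ) : ℝ) := by
      exact_mod_cast (show A.card + 2 ≤ K + 1 - P.card by omega)
    have hn2 : (A.card : ℝ) + 1 ≤ n := by exact_mod_cast (show A.card + 1 ≤ n by omega)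
    have hA0 : (0 : ℝ) ≤ A.card := Nat.cast_nonneg _
    set N : ℝ := ((K + 1 - P.card : ℕ) : ℝ) with hN
    have hN0 : (0 : ℝ) < N := by linarith
    have hN1 : (0 : ℝ) < N - 1 := by linarith
    rw [sub_nonneg, div_le_div_iff₀ (by positivity) hN0, one_mul]
    nlinarith
  · exact le_refl _

/-! ## The functional on the two sides of a junta representation -/

/-- `L_t(1) = K n^K / (K+1) > 0`. -/
theorem rbLt_one (h : Fin m → Fin K) {n t : ℕ} (hn : ∀ c, (cls h c).card = n) (htn : t + 2 ≤ n) (htK : t + 2 ≤ K) :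
    rbLt h n t (fun _ => 1) = (K : ℝ) * (n : ℝ) ^ K / ((K : ℝ) + 1) := by
  have := rbLt_indicator_succ h hn htn htK ∅ (by simp)
  rw [rbLt_congr_fun h n t (f' := fun Q => if (∅ : Finset (Fin m)) ⊆ Q then (1 : ℝ) else 0)
    (fun Q => by simp), this, if_pos (by simp)]
  simp

/-- `L_t(mono_h) = 0` (`1 ≤ t`): every monochromatic pair is a non-rainbow pattern of size `2 ≤ t + 1`. -/
theorem rbLt_cdist_colorVec (h : Fin m → Fin K) {n t : ℕ} (hn : ∀ c, (cls h c).card = n) (htn : t + 2 ≤ n)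
    (htK : t + 2 ≤ K) (ht1 : 1 ≤ t) : rbLt h n t (fun Q => cdist Q (colorVec h)) = 0 := by
  classical
  set M := (univ : Finset (Fin m × Fin m)).filter fun p => p.1 ≠ p.2 ∧ h p.1 = h p.2 with hM
  have hcount : ∀ Q : Finset (Fin m), 2 * cdist Q (colorVec h) =
      ∑ p ∈ M, (if ({p.1, p.2} : Finset (Fin m)) ⊆ Q then (1 : ℝ) else 0) := by
    intro Q
    rw [two_mul_cdist_colorVec, ← Finset.sum_filter]
    have hset : (M.filter fun p => ({p.1, p.2} : Finset (Fin m)) ⊆ Q) = monoPairs h Q := by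
      ext p
      simp only [hM, mem_filter, mem_univ, true_and, mem_monoPairs, insert_subset_iff, singleton_subset_iff]
      tauto
    rw [hset, Finset.sum_const, nsmul_eq_mul, mul_one]
  have h2 : rbLt h n t (fun Q => 2 * cdist Q (colorVec h)) = 0 := by
    rw [rbLt_congr_fun h n t hcount, rbLt_sum]
    refine Finset.sum_eq_zero fun p hp => ?_
    obtain ⟨hne, hpq⟩ := (mem_filter.1 hp).2
    rw [rbLt_indicator_succ h hn htn htK _ ((card_le_two).trans (by omega)), if_neg]
    intro hinj
    exact hne (hinj (by simp) (by simp) hpq)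
  rw [rbLt_smul] at h2
  linarith

/-- **Junta certificates are ε-exactly blind as soon as the class size exceeds the locality.** For a balanced colouring
`h` with `K` classes of common size `n`, a locality `w` with `2 ≤ w`, `w + 1 ≤ K`, `w + 1 ≤ n`, and every `ε > 0`: there is no
representation `cdist Q (colorVec h) - ε = ∑_l F_l(Q ∩ S_l)` on the `(K+1)`-sets with `F_l ≥ 0` and `#S_l ≤ w` — whatever
the number of terms. (For `#S_l = n` the class windows represent the column: the locality threshold is exactly the class
size.) [new] -/
theorem cdist_colorVec_not_juntaRep_small (h : Fin m → Fin K) {n w : ℕ} (hn : ∀ c, (cls h c).card = n)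
    (hw2 : 2 ≤ w) (hwK : w + 1 ≤ K) (hwn : w + 1 ≤ n) {ε : ℝ} (hε : 0 < ε) {ι : Type*} [Fintype ι]
    (S : ι → Finset (Fin m)) (F : ι → Finset (Fin m) → ℝ) (hS : ∀ l, (S l).card ≤ w) (hF : ∀ l P, 0 ≤ F l P) :
    ¬ ∀ Q : Finset (Fin m), Q.card = K + 1 → cdist Q (colorVec h) - ε = ∑ l, F l (Q ∩ S l) := by
  classical
  intro hrep
  -- the level-`t` functional with `t = w - 1`
  obtain ⟨t, rfl⟩ : ∃ t, w = t + 1 := ⟨w - 1, by omega⟩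
  have htn : t + 2 ≤ n := by omega
  have htK : t + 2 ≤ K := by omega
  have hL := rbLt_congr h n (show t + 1 ≤ K by omega) hrep
  have hleft : rbLt h n t (fun Q => cdist Q (colorVec h) - ε) = -(ε * ((K : ℝ) * (n : ℝ) ^ K / ((K : ℝ) + 1))) := by
    rw [rbLt_sub, rbLt_cdist_colorVec h hn htn htK (by omega), zero_sub]
    rw [rbLt_congr_fun h n t (f := fun _ => ε) (f' := fun Q => ε * 1) (fun Q => by ring), rbLt_smul,
      rbLt_one h hn htn htK]
  have hneg : rbLt h n t (fun Q => cdist Q (colorVec h) - ε) < 0 := by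
    rw [hleft, neg_lt_zero]
    have hKpos : (0 : ℝ) < K := by exact_mod_cast (show 0 < K by omega)
    have hnpos : (0 : ℝ) < n := by exact_mod_cast (show 0 < n by omega)
    positivity
  have hright : 0 ≤ rbLt h n t (fun Q => ∑ l, F l (Q ∩ S l)) := by
    rw [rbLt_sum]
    refine Finset.sum_nonneg fun l _ => ?_
    have hexp : ∀ Q : Finset (Fin m), F l (Q ∩ S l) =
        ∑ P ∈ (S l).powerset, F l P * (if Q ∩ S l = P then (1 : ℝ) else 0) := by
      intro Q
      rw [Finset.sum_eq_single_of_mem (Q ∩ S l) (mem_powerset.2 inter_subset_right)]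
      · simp
      · intro P _ hP
        rw [if_neg (Ne.symm hP), mul_zero]
    rw [rbLt_congr_fun h n t hexp, rbLt_sum]
    refine Finset.sum_nonneg fun P hP => ?_
    rw [rbLt_smul]
    exact mul_nonneg (hF l P) (rbLt_localLaw_nonneg h hn htn htK (mem_powerset.1 hP) (hS l))
  rw [hL] at hneg
  exact absurd hright (not_le.2 hneg)

/-- **Registered helper stub (junta certificates blind once the class size exceeds the locality).** Restatement of
`cdist_colorVec_not_juntaRep_small` with all parameters explicit. -/
theorem junta_blind_small : ∀ {m K n w : ℕ} (h : Fin m → Fin K), (∀ c, (cls h c).card = n) → 2 ≤ w → w + 1 ≤ K → w + 1 ≤ n → ∀ (ε : ℝ), 0 < ε → ∀ {ι : Type} [Fintype ι] (S : ι → Finset (Fin m)) (F : ι → Finset (Fin m) → ℝ), (∀ l, (S l).card ≤ w) → (∀ l P, 0 ≤ F l P) → ¬ ∀ Q : Finset (Fin m), Q.card = K + 1 → cdist Q (colorVec h) - ε = ∑ l, F l (Q ∩ S l) := by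
  intro m K n w h hn hw2 hwK hwn ε hε ι _ S F hS hF
  exact cdist_colorVec_not_juntaRep_small h hn hw2 hwK hwn hε S F hS hF

end

end Summit.PneNP.PneNP.Theorems
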